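import Mathlib.Logic.Basic
import HarnessLib

/-!
# Partition lemma, part 1/5: the finite grid of the rank-`≤ 1` residual cell (pure combinatorics)

HONEST FRAMING (cell `b2b-bsdres`, run/shared/lean/b2b/bsd-rank1-residual/, verbatim in every
file): the goal of the cell is to DELETE the COMBINATION-SHAPED residual classes of the
Birch–Swinnerton-Dyer formula for ALL analytic-rank `≤ 1` elliptic curves over `ℚ` — "full BSD
formula for every rank `≤ 1` curve in class `C`" assembled STRICTLY from published theorems — so
that the rank-`≤ 1` remainder becomes exactly the CONSTRUCTION-SHAPED classes, which are TYPED
(missing-input `Prop`s), NOT attempted. This is not "finishing BSD".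

This module is the Literature-free, purely finite part of the PARTITION LEMMA
(`Summits/BirchSwinnertonDyer/Rank1Residual/Partition.lean`, human GO 2026-08-19T21:53Z: "are we
sure the classes fully partition the space?"): the GRID of bit-vectors a pair `(E, p)` presents to
the covered rows of RESIDUAL-CASES.md §a.1 and to the residual classes of §a.2 —
`p ∈ {2} / {3} / [5, ∞)` × reduction at `p` (good ordinary / good supersingular / multiplicative /
additive) × image of `ρ̄_{E,p}` (surjective / irreducible non-surjective / reducible) × (im) ×
`r ∈ {0, 1}` × cm × ram × sst × anom × gvpar × `a_3 = 0` × `p` split in `K` × `p` ramified in `K`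
= `3·4·3·2·2·2⁸ = 36 864` cells (`Cell`) —, the Boolean shadows of the rows (`Cell.rowC1 …`,
hypotheses exactly as RESIDUAL-CASES §a.1 / the tree facts state them) and of the classes
(`Cell.x1 … Cell.x12` = the tree's `Rank1Residual.ClassX1 … ClassX12`, plus `x9im`, `x11a`, `x11b`
transcribed from §a.2 v5/v27), the consistency constraints every real pair satisfies
(`Cell.consistent`), and the classification TABLE `Cell.classify` (one primary target per cell).
The finite verification is part 2 (`Partition/Table.lean`); the binding to curves parts 3–5
(`Partition/Rows.lean`, `Partition/CellOf.lean`, `Partition.lean`). Bookkeeping only; nothing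
arithmetic is asserted; every declaration is [folklore] bookkeeping of the cell's own documents
(RESIDUAL-CASES.md §a.0–§a.2 v27; bsdN/HYPOTHESES.md; CLASSES.md).
-/

namespace Summit.BirchSwinnertonDyer.Rank1Residual

/-! ## §1 The finite grid -/

/-- The prime, binned: `p = 2`, `p = 3`, `p ≥ 5`. [folklore] -/
inductive PK | two | three | ge5
  deriving DecidableEq, Repr

/-- Reduction of `E` at `p`, binned: good ordinary, good supersingular, multiplicative, additive
(Silverman AEC VII.5.1 trichotomy + `p ∣ a_p`). [folklore] -/
inductive RedK | goodOrd | goodSS | mult | addv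
  deriving DecidableEq, Repr

/-- Image of `ρ̄_{E,p}`, binned: surjective; irreducible but not surjective; reducible. [folklore] -/
inductive ImK | surj | smallIrr | red
  deriving DecidableEq, Repr

/-- Analytic rank, binned (`r ≤ 1`): `0` or `1`. [folklore] -/
inductive RK | zero | one
  deriving DecidableEq, Repr

/-- `∀` over the three prime bins is decidable by enumeration. [folklore] -/
instance PK.decidableForall (P : PK → Prop) [DecidablePred P] : Decidable (∀ x, P x) :=
  decidable_of_iff (P .two ∧ P .three ∧ P .ge5)
    ⟨fun h x => by rcases x with _ | _ | _ <;> simp only [h], fun h => ⟨h _, h _, h _⟩⟩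

/-- `∀` over the four reduction bins is decidable by enumeration. [folklore] -/
instance RedK.decidableForall (P : RedK → Prop) [DecidablePred P] : Decidable (∀ x, P x) :=
  decidable_of_iff (P .goodOrd ∧ P .goodSS ∧ P .mult ∧ P .addv)
    ⟨fun h x => by rcases x with _ | _ | _ | _ <;> simp only [h], fun h => ⟨h _, h _, h _, h _⟩⟩

/-- `∀` over the three image bins is decidable by enumeration. [folklore] -/
instance ImK.decidableForall (P : ImK → Prop) [DecidablePred P] : Decidable (∀ x, P x) :=
  decidable_of_iff (P .surj ∧ P .smallIrr ∧ P .red)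
    ⟨fun h x => by rcases x with _ | _ | _ <;> simp only [h], fun h => ⟨h _, h _, h _⟩⟩

/-- `∀` over the two rank bins is decidable by enumeration. [folklore] -/
instance RK.decidableForall (P : RK → Prop) [DecidablePred P] : Decidable (∀ x, P x) :=
  decidable_of_iff (P .zero ∧ P .one)
    ⟨fun h x => by rcases x with _ | _ <;> simp only [h], fun h => ⟨h _, h _⟩⟩

/-- A cell of the grid: the bits of a pair `(E, p)` read by the covered rows and the residual
classes (RESIDUAL-CASES §a.0 predicates). [folklore] -/
structure Cell where
  /-- `p = 2 / 3 / ≥ 5`. -/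
  pk : PK
  /-- reduction type of `E` at `p`. -/
  red : RedK
  /-- image type of `ρ̄_{E,p}`. -/
  im : ImK
  /-- (im): some `σ ∈ G_{ℚ(μ_{p^∞})}` with `T_pE/(σ-1) ≅ ℤ_p`. -/
  bigIm : Bool
  /-- analytic rank `0 / 1`. -/
  rk : RK
  /-- `E` has CM. -/
  cm : Bool
  /-- ram(p): a multiplicative `q ≠ p` with `p ∤ v_q(Δ_min)`. -/
  ram : Bool
  /-- `E` semistable. -/
  sst : Bool
  /-- anom(p): red ∧ good ∧ `a_p ≡ 1 (mod p)`. -/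
  anom : Bool
  /-- gvpar(p): the Greenberg–Vatsal parity condition on some rational `p`-line. -/
  gvpar : Bool
  /-- `a_3 = 0`. -/
  a3zero : Bool
  /-- `p` split in the CM field `K` (junk unless cm). -/
  cmSplit : Bool
  /-- `p` ramified in the CM field `K` (junk unless cm). -/
  cmRam : Bool
  deriving DecidableEq, Repr

namespace Cell

variable (c : Cell)

/-! ### Cell-level atoms (Boolean; lower-case names: they live on cells, not on curves) -/

/-- `p = 2`. [folklore] -/ def isTwo : Bool := c.pk == .two
/-- `p ≠ 2`. [folklore] -/ def odd : Bool := c.pk != .two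
/-- `2 < p` (same bit as `odd`). [folklore] -/ def gt2 : Bool := c.pk != .two
/-- `3 ≤ p` (same bit as `odd`). [folklore] -/ def ge3 : Bool := c.pk != .two
/-- `p = 3`. [folklore] -/ def isThree : Bool := c.pk == .three
/-- `3 < p`. [folklore] -/ def gt3 : Bool := c.pk == .ge5
/-- `5 ≤ p` (same bit as `gt3`). [folklore] -/ def ge5 : Bool := c.pk == .ge5
/-- good(p). [folklore] -/ def good : Bool := c.red == .goodOrd || c.red == .goodSS
/-- ord(p). [folklore] -/ def goodOrd : Bool := c.red == .goodOrd
/-- ss(p). [folklore] -/ def goodSS : Bool := c.red == .goodSS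
/-- mult(p). [folklore] -/ def mult : Bool := c.red == .mult
/-- add(p). [folklore] -/ def addv : Bool := c.red == .addv
/-- irr(p). [folklore] -/ def irr : Bool := c.im != .red
/-- red(p). [folklore] -/ def isRed : Bool := c.im == .red
/-- surj(p). [folklore] -/ def surj : Bool := c.im == .surj
/-- irr(p) ∧ ¬surj(p). [folklore] -/ def smallIrr : Bool := c.im == .smallIrr
/-- `r = 0`. [folklore] -/ def r0 : Bool := c.rk == .zero
/-- `r = 1`. [folklore] -/ def r1 : Bool := c.rk == .one

/-- The consistency constraints satisfied by the cell of every real `(E, p)` (`cellOf_consistent`):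
anom ⇒ red ∧ ord; red ∧ good ∧ `p` odd ⇒ ord; additive ⇒ not semistable; irr ∧ ¬surj ⇒ ¬(im).
[folklore] -/
def consistent : Bool :=
  (!c.anom || (c.isRed && c.goodOrd)) &&
  (!(c.isRed && c.odd && c.good) || c.goodOrd) &&
  (!c.addv || !c.sst) &&
  (!c.smallIrr || !c.bigIm)

/-! ### Covered rows (RESIDUAL-CASES §a.1), cell level -/

/-- C1 (Skinner 2016 Thm. C): `r = 0 ∧ p ≥ 3 ∧ (ord ∨ mult) ∧ irr ∧ ram`. [folklore] -/
def rowC1 : Bool := c.r0 && c.ge3 && (c.goodOrd || c.mult) && c.irr && c.ram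
/-- C2 (BCS 2025 Cor. 1.3.1; PUB\*): `¬cm ∧ p > 3 ∧ ord ∧ irr ∧ (im)`. [folklore] -/
def rowC2 : Bool := !c.cm && c.gt3 && c.goodOrd && c.irr && c.bigIm
/-- C3 (JSW 2017 Thm. 1.2.1): `r = 1 ∧ sst ∧ good ∧ irr ∧ (p ≥ 5 ∨ (p = 3 ∧ (ord ∨ a_3 = 0)))`.
[folklore] -/
def rowC3 : Bool := c.r1 && c.sst && c.good && c.irr && (c.ge5 || (c.isThree && (c.goodOrd || c.a3zero)))
/-- C6 (CGS 2025 Thm. D): `p > 2 ∧ red ∧ good ∧ ¬anom`. [folklore] -/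
def rowC6 : Bool := c.gt2 && c.isRed && c.good && !c.anom
/-- C7 (GV 2000 + Greenberg 1999 + Kato chain): `r = 0 ∧ ¬cm ∧ p ≠ 2 ∧ ord ∧ red ∧ gvpar`. [folklore] -/
def rowC7 : Bool := c.r0 && !c.cm && c.odd && c.goodOrd && c.isRed && c.gvpar
/-- C8 (Rubin 1991 / Burungale–Flach 2024): `cm ∧ r = 0`. [folklore] -/
def rowC8 : Bool := c.cm && c.r0
/-- C10 (Kobayashi 2013 Cor. 1.4): `cm ∧ r = 1 ∧ p ≠ 2 ∧ good`. [folklore] -/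
def rowC10 : Bool := c.cm && c.r1 && c.odd && c.good
/-- C16 (Yan–Zhu 2026 Thm. 4.15; PUB\*): `p = 3 ∧ ord ∧ irr ∧ (surj ∨ ram)`. [folklore] -/
def rowC16 : Bool := c.isThree && c.goodOrd && c.irr && (c.surj || c.ram)
/-- C17 (Li–Liu–Tian 2024 Thm. 1.1): `cm ∧ r = 1 ∧ p ≠ 2 ∧ p split in K`. [folklore] -/
def rowC17 : Bool := c.cm && c.r1 && c.odd && c.cmSplit

/-- Some class-level covered row applies. [folklore] -/
def covered : Bool :=
  c.rowC1 || c.rowC2 || c.rowC3 || c.rowC6 || c.rowC7 || c.rowC8 || c.rowC10 || c.rowC16 || c.rowC17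

/-- Some FLAG-FREE published class-level row applies (C1, C3 at ordinary `p`, C6, C8, C10, C17;
C7 is printed but census-literal `GV-chain`, counted here as flag-free-in-print). [folklore] -/
def coveredPub : Bool :=
  c.rowC1 || (c.rowC3 && c.goodOrd) || c.rowC6 || c.rowC7 || c.rowC8 || c.rowC10 || c.rowC17

/-! ### Residual classes (RESIDUAL-CASES §a.2; tree `ClassX1 … ClassX12` + X9im, X11a, X11b), cell level -/

/-- X1: `2 < p ∧ red ∧ good ∧ anom ∧ ¬(r = 0 ∧ gvpar)`. [folklore] -/
def x1 : Bool := c.gt2 && c.isRed && c.good && c.anom && !(c.r0 && c.gvpar)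
/-- X2: `p ≠ 2 ∧ red ∧ mult`. [folklore] -/
def x2 : Bool := c.odd && c.isRed && c.mult
/-- X3: `red ∧ add`. [folklore] -/
def x3 : Bool := c.isRed && c.addv
/-- X4: `p ≠ 2 ∧ add ∧ irr`. [folklore] -/
def x4 : Bool := c.odd && c.addv && c.irr
/-- X5: `p = 2`. [folklore] -/
def x5 : Bool := c.isTwo
/-- X6: `ss ∧ sst ∧ (5 ≤ p ∨ a_3 = 0)`. [folklore] -/
def x6 : Bool := c.goodSS && c.sst && (c.ge5 || c.a3zero)
/-- X7: `ss ∧ ¬sst`. [folklore] -/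
def x7 : Bool := c.goodSS && !c.sst
/-- X8: `p = 3 ∧ ss(3) ∧ a_3 ≠ 0`. [folklore] -/
def x8 : Bool := c.isThree && c.goodSS && !c.a3zero
/-- X9 (tree reading): `¬cm ∧ ord ∧ 5 ≤ p ∧ irr ∧ ¬surj ∧ (r = 1 → ¬sst)`. [folklore] -/
def x9 : Bool := !c.cm && c.goodOrd && c.ge5 && c.irr && !c.surj && !(c.r1 && c.sst)
/-- X9 as printed (`¬(im)`): `¬cm ∧ ord ∧ 5 ≤ p ∧ irr ∧ ¬(im) ∧ (r = 1 → ¬sst)`. [folklore] -/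
def x9im : Bool := !c.cm && c.goodOrd && c.ge5 && c.irr && !c.bigIm && !(c.r1 && c.sst)
/-- X10: `p = 3 ∧ ord(3) ∧ irr(3) ∧ ((r = 0 ∧ ¬ram(3)) ∨ (r = 1 ∧ ¬sst))`. [folklore] -/
def x10 : Bool := c.isThree && c.goodOrd && c.irr && ((c.r0 && !c.ram) || (c.r1 && !c.sst))
/-- X11 (tree v3): `mult ∧ irr ∧ (¬ram ∨ (r = 1 ∧ ¬sst) ∨ (r = 1 ∧ p = 3))`. [folklore] -/
def x11 : Bool := c.mult && c.irr && (!c.ram || (c.r1 && !c.sst) || (c.r1 && c.isThree))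
/-- X11a (v5): `r = 0 ∧ p ≠ 2 ∧ mult ∧ irr ∧ ¬ram`. [folklore] -/
def x11a : Bool := c.r0 && c.odd && c.mult && c.irr && !c.ram
/-- X11b (v5): `r = 1 ∧ p ≠ 2 ∧ mult ∧ irr`. [folklore] -/
def x11b : Bool := c.r1 && c.odd && c.mult && c.irr
/-- X12: `cm ∧ r = 1 ∧ (p = 2 ∨ (p = 3 ∧ ¬split(3)) ∨ p ramified in K ∨ ¬good)`. [folklore] -/
def x12 : Bool := c.cm && c.r1 && (c.isTwo || (c.isThree && !c.cmSplit) || c.cmRam || !c.good)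

/-- Some residual class applies (tree classes X1–X12, plus X9im, X11a, X11b). [folklore] -/
def residual : Bool :=
  c.x1 || c.x2 || c.x3 || c.x4 || c.x5 || c.x6 || c.x7 || c.x8 || c.x9 || c.x10 || c.x11 || c.x12 ||
    c.x9im || c.x11a || c.x11b

/-- Residual in the tree's v3 classes X1–X12 only (used to exhibit the gap F1). [folklore] -/
def residualV3 : Bool :=
  c.x1 || c.x2 || c.x3 || c.x4 || c.x5 || c.x6 || c.x7 || c.x8 || c.x9 || c.x10 || c.x11 || c.x12

/-- The F3 locus: consistent cells whose ONLY covering row is C2 (PUB\*) and which lie in no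
residual class. [folklore] -/
def c2Only : Bool := c.consistent && c.rowC2 && !c.residual &&
  !(c.rowC1 || c.rowC3 || c.rowC6 || c.rowC7 || c.rowC8 || c.rowC10 || c.rowC16 || c.rowC17)

/-! ## §2 The classification table and its finite verification -/

/-- The class-level covered rows of RESIDUAL-CASES §a.1 used by the partition. [folklore] -/
inductive Row | C1 | C2 | C3 | C6 | C7 | C8 | C10 | C16 | C17
  deriving DecidableEq, Repr

/-- The residual classes (tree X1–X12; printed variant X9im; v5 split X11a / X11b). [folklore] -/
inductive XClass | X1 | X2 | X3 | X4 | X5 | X6 | X7 | X8 | X9 | X9im | X10 | X11 | X11a | X11b | X12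
  deriving DecidableEq, Repr

/-- The target of a cell. [folklore] -/
inductive Verdict
  | covered (r : Row)
  | residual (x : XClass)
  | inconsistent
  deriving DecidableEq, Repr

/-- The row's hypotheses on a cell. [folklore] -/
def Row.holds : Row → Cell → Bool
  | .C1, c => c.rowC1 | .C2, c => c.rowC2 | .C3, c => c.rowC3 | .C6, c => c.rowC6
  | .C7, c => c.rowC7 | .C8, c => c.rowC8 | .C10, c => c.rowC10 | .C16, c => c.rowC16
  | .C17, c => c.rowC17

/-- The class's predicate on a cell. [folklore] -/
def XClass.holds : XClass → Cell → Bool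
  | .X1, c => c.x1 | .X2, c => c.x2 | .X3, c => c.x3 | .X4, c => c.x4 | .X5, c => c.x5
  | .X6, c => c.x6 | .X7, c => c.x7 | .X8, c => c.x8 | .X9, c => c.x9 | .X9im, c => c.x9im
  | .X10, c => c.x10 | .X11, c => c.x11 | .X11a, c => c.x11a | .X11b, c => c.x11b | .X12, c => c.x12

/-- **The classification table** (one PRIMARY target per cell; flag-free PUB rows are preferred to
PUB\* rows, rows to residual classes; reading order of RESIDUAL-CASES §a.1/§a.2). [folklore] -/
def classify (c : Cell) : Verdict :=
  if !c.consistent then .inconsistent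
  else if c.isTwo then .residual .X5
  else if c.cm then
    (if c.r0 then .covered .C8
     else if c.cmSplit then .covered .C17
     else if c.good then .covered .C10
     else .residual .X12)
  else match c.red with
    | .addv => if c.isRed then .residual .X3 else .residual .X4
    | .mult => if c.isRed then .residual .X2
        else if c.r0 then (if c.ram then .covered .C1 else .residual .X11a)
        else .residual .X11b
    | .goodSS =>
        if c.isThree && !c.a3zero then .residual .X8
        else if !c.sst then .residual .X7
        else if c.r1 then .covered .C3
        else .residual .X6
    | .goodOrd =>
        if c.isRed then
          (if !c.anom then .covered .C6
           else if c.r0 && c.gvpar then .covered .C7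
           else .residual .X1)
        else if c.r0 && c.ram then .covered .C1
        else if c.r1 && c.sst then .covered .C3
        else if c.isThree then (if c.surj || c.ram then .covered .C16 else .residual .X10)
        else if c.bigIm then .covered .C2
        else if !c.surj then .residual .X9
        else .residual .X9im

/-- What the table must satisfy on a cell: the named target's hypotheses hold there, and only
inconsistent cells are discarded. [folklore] -/
def classifySound (c : Cell) : Bool :=
  match classify c with
  | .covered r => r.holds c
  | .residual x => x.holds c
  | .inconsistent => !c.consistent

/-! ### Shapes and specifications checked in `Partition/Table.lean` -/

/-- Shape F1: `(mult, irr, r = 1, ram, sst, p ≥ 5, ¬cm)` — the withdrawn C4's domain. [folklore] -/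
def f1Shape : Bool := c.mult && c.irr && c.r1 && c.ram && c.sst && c.ge5 && !c.cm

/-- Shape F2: `(¬cm, ord, p ≥ 5, surj, ¬(im), (r = 0 ∧ ¬ram) ∨ (r = 1 ∧ ¬sst))` — empty for real
curves by Serre (not a tree theorem). [folklore] -/
def f2Shape : Bool :=
  !c.cm && c.goodOrd && c.ge5 && c.surj && !c.bigIm && ((c.r0 && !c.ram) || (c.r1 && !c.sst))

/-- The v3 gap specification: a consistent cell outside every row and every v3 class has shape F1
(and lies in X11b) or shape F2 (and lies in X9im). [folklore] -/
def v3GapSpec : Bool :=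
  !(c.consistent && !(c.covered || c.residualV3)) || ((c.f1Shape && c.x11b) || (c.f2Shape && c.x9im))

/-- Converse specification: every consistent cell of shape F1 or F2 IS outside every row and every
v3 class. [folklore] -/
def v3GapExact : Bool := !(c.consistent && (c.f1Shape || c.f2Shape)) || !(c.covered || c.residualV3)

/-- The F3 specification: `c2Only` holds iff the cell is consistent with
`¬cm ∧ p ≥ 5 ∧ ord ∧ (im) ∧ surj ∧ ((r = 0 ∧ ¬ram) ∨ (r = 1 ∧ ¬sst))`. [folklore] -/
def c2OnlySpec (c : Cell) : Bool :=
  c.c2Only == (c.consistent && !c.cm && c.ge5 && c.goodOrd && c.bigIm && c.surj &&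
    ((c.r0 && !c.ram) || (c.r1 && !c.sst)))

end Cell

end Summit.BirchSwinnertonDyer.Rank1Residual
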